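import Literature.NumberTheory.Automorphic.BookerStrongArtin
import Literature.NumberTheory.Automorphic.StrongArtinGL2
import HarnessLib

/-!
# Booker 2003 fact: bridge to `IsPiOfArtinRep` and the solvable-image sanity check

Companion of the LIGHT module `Automorphic/BookerStrongArtin` (which vendors Booker's Corollary,
Ann. of Math. 158 (2003), p. 1090, with the conclusion `π = π(σ)` written out) for users that do
import the Langlands–Tunnell cone (`Automorphic/StrongArtinGL2`):

* `booker_strongArtin_of_artinConjecture_iff` — the light statement is, by `Iff.rfl`, the statement
  with `IsPiOfArtinRep σ π.1`;
* `booker_conclusion_of_isSolvable` — in the solvable-image cases the conclusion already follows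
  from the Langlands–Tunnell named fact `strongArtin_of_isSolvable` with no holomorphy input
  (Gelbart 1997, Thm. 2.1), so the fact's content is the icosahedral case, exactly as Booker says
  (p. 1090). (Re-landed here from revision 1 of `BookerStrongArtin`, whose imports it forced.)
-/

noncomputable section

open scoped MatrixGroups NumberField
open NumberField IsDedekindDomain Literature.NumberTheory.Automorphic

namespace Literature.NumberTheory.Automorphic

/-- The light Booker fact is definitionally the statement "`L(s, σ)` entire ⇒ `∃ hcpt π,
IsPiOfArtinRep σ π.1`" (`IsPiOfArtinRep`, `FrobSatakeCompatibleAt` unfold to the written-out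
conclusion). [cite: Booker2003, Corollary (p. 1090)] -/
theorem booker_strongArtin_of_artinConjecture_iff :
    booker_strongArtin_of_artinConjecture ↔
      ∀ (σ : GaloisRepresentations.FramedArtinRep ℚ 2), σ.toGaloisRep.IsIrreducible →
        GaloisRepresentations.LFunction.HasEntireContinuation
            (GaloisRepresentations.artinLFunction σ.toArtinRep) →
          ∃ (hcpt : isCompact_glFiniteIntegralLevel 2 ℚ) (π : CuspidalAutomorphicRepData 2 ℚ hcpt),
            IsPiOfArtinRep σ π.1 :=
  Iff.rfl

/-- Sanity instance of the shape: in the solvable-image cases the conclusion of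
`booker_strongArtin_of_artinConjecture` already follows from the Langlands–Tunnell named fact
`strongArtin_of_isSolvable` with no holomorphy input (Gelbart 1997, Thm. 2.1) — so the fact's
content is the icosahedral case, exactly as Booker says (p. 1090). [cite: Gelbart1997, Thm. 2.1] -/
theorem booker_conclusion_of_isSolvable (hSA : strongArtin_of_isSolvable)
    (σ : GaloisRepresentations.FramedArtinRep ℚ 2) (hirr : σ.toGaloisRep.IsIrreducible)
    (hsolv : IsSolvable (GaloisRepresentations.projectiveImage σ.toMonoidHom)) :
    ∃ (hcpt : isCompact_glFiniteIntegralLevel 2 ℚ) (π : CuspidalAutomorphicRepData 2 ℚ hcpt),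
      IsPiOfArtinRep σ π.1 :=
  hSA σ hirr hsolv

end Literature.NumberTheory.Automorphic
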